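import Summits.QuantumFields.QCD.Theses.CentreStabilisedCircle
import Summits.QuantumFields.QCD.Theorems.CentreStabilisedCircleSlabToTorusFermions

/-!
# `SlabToTorus` (stmt-QuantumFields-10529) — route CentreStabilisedCircle, sub-problem QCD

The bookkeeping support item of the route: if the centre-stabilised circle theory clusters at some
rate `Δ` for all circle lengths `N_t ≥ ℓ₀/a_k` under a deformation/twist profile `(h, θ)(k, N_t)`
that is switched off once `a_k N_t ≥ ℓ₁` (the conclusion of `CircleContinuity`), then the tree's
torus functional has the volume-uniform lattice mass gap `(reg.scheme m 0 0).HasLatticeMassGap Δ`.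

Proof. Take the circle length equal to the torus side, `N_t = 2S+1`. Along the regularisation
`a_k L_k → ∞`, so for all large `k` and every admissible torus `S ≥ L_k` one has
`a_k (2S+1) ≥ a_k L_k ≥ max ℓ₀ ℓ₁`: the window condition holds and the profile vanishes there,
`(h, θ) = (0, 0)`. At `N_t = N_s = 2S+1`, `h = 0`, `θ = 0` the circle connected correlation IS the
torus one (`qcdCircleConnectedCorr_eq` of the helper file
`CentreStabilisedCircleSlabToTorusFermions`: sites `ℤ_N × (ℤ/N)³ ≃ (ℤ/N)⁴` by `Fin.snocEquiv`,
gauge fields by `MeasurableEquiv.piCongrLeft` (product Haar to product Haar), Wilson weights equal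
up to the constant `e^{−3β#P}`, Wilson–Dirac matrices equal up to the relabelling of quark
variables, Berezin integrals equal by Berezin's change of variables with unit Jacobian, all
constants cancelling in the ratio `Z(X)/Z(1)` with no positivity of `Z(1)` needed), so the circle
clustering bound is literally the torus bound with the same constant `C` and rate `Δ`.
-/

namespace Summit.QuantumFields.QCD.Theorems

open Literature.MathematicalPhysics.QuantumFieldTheory
open CentreStabilisedCircleSlabToTorus

/-- **`SlabToTorus` holds** (item stmt-QuantumFields-10529 of route CentreStabilisedCircle, literally
the route decl): for every `N_f`, regularisation `reg` and mass tuple `m`, if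
`reg.HasCircleClustering m (ℓ₀ ≤ a_k N_t) hP θP` for some `ℓ₀ > 0`, `ℓ₁` and a profile with
`hP k N_t = 0 ∧ θP k N_t = 0` whenever `ℓ₁ ≤ a_k N_t`, then `∃ Δ > 0, (reg.scheme m 0 0).HasLatticeMassGap Δ`
— with the SAME rate `Δ` and constants: at `N_t = N_s = 2S+1 ≥ L_k` (eventually in the window and
past `ℓ₁`, since `a_k L_k → ∞`) the undeformed, untwisted circle functional is the torus functional
(`qcdCircleConnectedCorr_eq`). -/
theorem slabToTorus_proof : Summit.QuantumFields.QCD.Theses.CentreStabilisedCircle.SlabToTorus := by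
  intro Nf reg m h
  obtain ⟨ℓ₀, ℓ₁, -, hP, θP, hprof, Δ, hΔ, hcl⟩ := h
  refine ⟨Δ, hΔ, fun R R' A B => ?_⟩
  obtain ⟨C, hC⟩ := hcl R R' A B
  refine ⟨C, ?_⟩
  have hL : ∀ᶠ k in Filter.atTop, max ℓ₀ ℓ₁ ≤ reg.a k * reg.L k :=
    reg.tendsto_L.eventually_ge_atTop _
  filter_upwards [hC, hL] with k hk hkL S hS n hn
  change reg.L k ≤ S at hS
  have hLS : reg.a k * reg.L k ≤ reg.a k * ((2 * S + 1 : ℕ) : ℝ) :=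
    mul_le_mul_of_nonneg_left (by exact_mod_cast (by omega : reg.L k ≤ 2 * S + 1)) (reg.a_pos k).le
  have h0 : ℓ₀ ≤ reg.a k * ((2 * S + 1 : ℕ) : ℝ) := (le_max_left _ _).trans (hkL.trans hLS)
  have h1 : ℓ₁ ≤ reg.a k * ((2 * S + 1 : ℕ) : ℝ) := (le_max_right _ _).trans (hkL.trans hLS)
  obtain ⟨hh, hθ⟩ := hprof k (2 * S + 1) h1
  have hkS := hk (2 * S + 1) h0 S le_rfl n hn
  rw [hh, hθ, qcdCircleConnectedCorr_eq] at hkS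
  exact hkS

end Summit.QuantumFields.QCD.Theorems
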